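import Summits.HubbardSuperconductivity.HubbardSuperconductivity.Theorems.AnisotropyChordTransferFibre3FinGradCell
import Summits.HubbardSuperconductivity.HubbardSuperconductivity.Theorems.AnisotropyChordTransferFibre3CruxWindow

/-!
# Route `AnisotropyChord` / H0 rotor rung: FIN layer 3 — SOUNDNESS of the per-`L` regime certificate `mholeCheck2`: `mHole ≥ 0` for every ground profile

★ `mHole_nonneg_of_cells`: for `7 ≤ L`, a cell list `cells` with `mholeCheck2 L cells = true` (`…Fibre3FinGradCell`, a kernel
computation with zero data) and every `0 < Δ < 1`: every ground two-magnon profile at `(L, Δ)` has `0 ≤ mHole L Δ f`, i.e.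
`T⁺ ≤ ε₁(1 − 5/V + 6/V²)/2` — the first half of the regime clause of the GM₃ assembly (`gm3_allL`), FIN-class.
The chain: a-priori window `0 < λ₂ ≤ .0982θ²` (p1 `forall_ground_of_window_7`) → `f = groundF L λ₂`, `Δ = deltaOfLam L λ₂`
(p1 `ground_eq_explicit`, `ground_delta_eq`) → `λ₂·D ≤ lamTop L` (`π < piHi`) → a cell `[a,b] ∋ λ₂·D` of the list (`cover`) →
either the cell is vacuous (`Δ ≤ Δ_hi < 0`, by `mem_delta_cell`) or `N = ‖Π⁰‖² > 0`, `S = Σ Π⁰·C0fn` enclosed (`mem_PiNormSq`,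
`mem_SIvD` + `mem_cellOracle`, `tabEncl_fTab`), `T⁺ = 3λ₂ + S/N` (p1 `sum_piR_C0fn`) `≤ hi(tplusIv2) ≤ lo(boundIv) ≤ ε₁cos2theta/2`.
The kernel facts for `L = 9` and the theorem `mHole_nonneg_nine` follow in `…Fibre3FinMHoleL9*`.
Prover seat `hubbard-h0-rotor-p3` g4; helper for stmt-HubbardSuperconductivity-23918 (piece A of rung 19089; `--supports`, helper class).
WHAT THIS IS NOT: nothing here proves superconductivity in the Hubbard model (rotor TARGET as worded stays FALSE, g15 verdict); it is
the soundness of a FIN certificate for ONE hypothesis (regime clause) of ONE conditional reduction. Tree imports only; no sorry.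
-/

set_option linter.dupNamespace false
set_option autoImplicit false

noncomputable section

namespace Summit.HubbardSuperconductivity.HubbardSuperconductivity.Theorems.AnisotropyChord.Transfer.Fibre3

namespace FinCell

open scoped BigOperators
open Finset Hole2

variable (L : ℕ) [NeZero L]

/-! ## The cell cover -/

omit [NeZero L] in
/-- a point of `[a, last]` lies in some checked cell of `a :: b :: rest`. [folklore] -/
theorem cover : ∀ (rest : List ℤ) (a b : ℤ) (x : ℝ), cellsOK2 L (a :: b :: rest) = true →
    (a : ℝ) ≤ x → x ≤ ((cellsLast (a :: b :: rest) : ℤ) : ℝ) →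
    ∃ c d : ℤ, mholeCellOK2 L c d = true ∧ (c : ℝ) ≤ x ∧ x ≤ (d : ℝ) := by
  intro rest
  induction rest with
  | nil =>
    intro a b x hok ha hb
    unfold cellsOK2 at hok
    rw [Bool.and_eq_true] at hok
    unfold cellsLast cellsLast at hb
    exact ⟨a, b, hok.1, ha, hb⟩
  | cons c rest ih =>
    intro a b x hok ha hb
    unfold cellsOK2 at hok
    rw [Bool.and_eq_true] at hok
    by_cases hxb : x ≤ (b : ℝ)
    · exact ⟨a, b, hok.1, ha, hxb⟩
    · push Not at hxb
      have hb' : x ≤ ((cellsLast (b :: c :: rest) : ℤ) : ℝ) := by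
        unfold cellsLast at hb; exact hb
      exact ih b c x hok.2 hxb.le hb'

/-! ## The window bound in fixed point -/

omit [NeZero L] in
/-- `λ ≤ .0982·(2π/L)²` ⇒ `λ·D ≤ lamTop L`. [folklore] -/
theorem lam_mul_D_le_lamTop (hL : 1 ≤ L) {lam : ℝ} (hlam : lam ≤ 0.0982 * (2 * Real.pi / L) ^ 2) :
    lam * ((D : ℤ) : ℝ) ≤ ((lamTop L : ℤ) : ℝ) := by
  have hLpos : (0 : ℝ) < L := by exact_mod_cast (show 0 < L by omega)
  have hD := D_pos
  obtain ⟨_, hpi⟩ := pi_mem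
  have hpi0 := Real.pi_pos
  unfold lamTop
  have hq : ((((982 : ℚ) / 10000 * 4 * piHi ^ 2 * (D : ℚ) / ((L : ℚ) ^ 2) : ℚ)) : ℝ)
      = 982 / 10000 * 4 * ((piHi : ℚ) : ℝ) ^ 2 * ((D : ℤ) : ℝ) / (L : ℝ) ^ 2 := by
    push_cast; ring
  have hceil := Int.le_ceil ((982 : ℚ) / 10000 * 4 * piHi ^ 2 * (D : ℚ) / ((L : ℚ) ^ 2))
  have hceil' : ((((982 : ℚ) / 10000 * 4 * piHi ^ 2 * (D : ℚ) / ((L : ℚ) ^ 2) : ℚ)) : ℝ)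
      ≤ ((⌈(982 : ℚ) / 10000 * 4 * piHi ^ 2 * (D : ℚ) / ((L : ℚ) ^ 2)⌉ : ℤ) : ℝ) := by exact_mod_cast hceil
  rw [hq] at hceil'
  refine le_trans ?_ hceil'
  have h1 : (2 * Real.pi / L) ^ 2 ≤ 4 * ((piHi : ℚ) : ℝ) ^ 2 / (L : ℝ) ^ 2 := by
    rw [div_pow, show (2 * Real.pi) ^ 2 = 4 * Real.pi ^ 2 by ring]
    refine div_le_div_of_nonneg_right ?_ (by positivity)
    nlinarith
  have h2 : lam ≤ 982 / 10000 * (4 * ((piHi : ℚ) : ℝ) ^ 2 / (L : ℝ) ^ 2) := by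
    refine hlam.trans ?_
    rw [show (0.0982 : ℝ) = 982 / 10000 by norm_num]
    exact mul_le_mul_of_nonneg_left h1 (by norm_num)
  have := mul_le_mul_of_nonneg_right h2 hD.le
  refine this.trans (le_of_eq ?_)
  ring

/-! ## The regime bound in fixed point -/

omit [NeZero L] in
/-- `ε₁(1 − 5/V + 6/V²)/2 ∈ boundIv L` (`3 ≤ L`). [folklore] -/
theorem mem_bound (hL : 3 ≤ L) : mem (eps1 L * (1 - 5 / (L : ℝ) ^ 2 + 6 / ((L : ℝ) ^ 2) ^ 2) / 2) (boundIv L) := by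
  have hLpos : (0 : ℝ) < L := by exact_mod_cast (show 0 < L by omega)
  have hc := mem_cosIv hL (show 1 < L by omega)
  have hcos : mem (1 - Real.cos (2 * Real.pi / L)) (isub (iconst 1) (cosIv L 1)) := by
    have := mem_isub (mem_iconst 1) hc
    simp only [Int.cast_one, Nat.cast_one, mul_one] at this
    exact this
  have h5 : 5 * (L * L) ≤ L * L * (L * L) := Nat.mul_le_mul_right (L * L) (by nlinarith)
  have hscale := mem_iscale (L * L * (L * L) - 5 * (L * L) + 6) hcos
  have hLL : (0 : ℤ) < 2 * ((L : ℤ) * L * (L * L)) := by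
    have : (0 : ℤ) < L := by exact_mod_cast (show 0 < L by omega)
    positivity
  have h := mem_idivn hscale hLL
  unfold boundIv
  have e : ((L * L * (L * L) - 5 * (L * L) + 6 : ℕ) : ℝ) * (1 - Real.cos (2 * Real.pi / L))
      / (((2 * ((L : ℤ) * L * (L * L)) : ℤ)) : ℝ)
      = eps1 L * (1 - 5 / (L : ℝ) ^ 2 + 6 / ((L : ℝ) ^ 2) ^ 2) / 2 := by
    rw [Nat.cast_add, Nat.cast_sub h5]
    unfold eps1
    push_cast
    field_simp
  rw [e] at h
  exact h

/-! ## The theorem -/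

/-- ★★ SOUNDNESS OF THE REGIME CERTIFICATE: `mholeCheck2 L cells = true` ⇒ `0 ≤ mHole L Δ f` for every ground profile, every
`0 < Δ < 1` (`7 ≤ L`). [folklore] -/
theorem mHole_nonneg_of_cells (hL : 7 ≤ L) (cells : List ℤ) (hchk : mholeCheck2 L cells = true)
    {Δ : ℝ} (hΔ0 : 0 < Δ) (hΔ1 : Δ < 1) :
    ∀ lam2 : ℝ, ∀ f : Tor L → ℝ, IsGroundTwoMagnon L Δ lam2 f → 0 ≤ mHole L Δ f := by
  refine forall_ground_of_window_7 L hL hΔ0.le hΔ1 (fun _ f => 0 ≤ mHole L Δ f) ?_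
  intro lam2 f hf hlam0 hlamle
  have hD := D_pos
  -- unpack the certificate
  unfold mholeCheck2 at hchk
  simp only [Bool.and_eq_true, decide_eq_true_eq] at hchk
  obtain ⟨⟨⟨hhead, hlen⟩, htop⟩, hok⟩ := hchk
  -- the list has the shape `0 :: b :: rest`
  obtain ⟨a, b, rest, hcells⟩ : ∃ a b : ℤ, ∃ rest : List ℤ, cells = a :: b :: rest := by
    match cells, hlen with
    | a :: b :: rest, _ => exact ⟨a, b, rest, rfl⟩
  subst hcells
  have ha0 : a = 0 := by simpa using hhead
  subst ha0
  -- locate the cell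
  set x : ℝ := lam2 * ((D : ℤ) : ℝ) with hx
  have hx0 : ((0 : ℤ) : ℝ) ≤ x := by rw [hx]; push_cast; positivity
  have hxtop : x ≤ ((cellsLast ((0 : ℤ) :: b :: rest) : ℤ) : ℝ) :=
    (lam_mul_D_le_lamTop L (by omega) hlamle).trans (by exact_mod_cast htop)
  obtain ⟨c, d, hcell, hcx, hxd⟩ := cover L rest 0 b x hok hx0 hxtop
  -- the explicit profile
  have hfe : f = groundF L lam2 := ground_eq_explicit L (by omega) hΔ0.le hΔ1 hf
  have hΔe : Δ = deltaOfLam L lam2 := ground_delta_eq L (by omega) hΔ0.le hΔ1 hf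
  have hf2 : IsTwoMagnon L Δ lam2 f := hf.1
  -- unpack the cell check
  unfold mholeCellOK2 at hcell
  simp only [Bool.and_eq_true, Bool.or_eq_true, decide_eq_true_eq] at hcell
  obtain ⟨hgc, hcase⟩ := hcell
  rcases hcase with hvac | ⟨hN, hT⟩
  · -- vacuous cell: Δ ≤ Δ_hi < 0
    exfalso
    have hmd := mem_delta_cell L (by omega) hlam0 hcx hxd hgc
    rw [← hΔe] at hmd
    obtain ⟨_, hhi⟩ := hmd
    have : ((((deltaIv L c d).2 : ℤ)) : ℝ) < 0 := by exact_mod_cast hvac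
    nlinarith
  · -- the main case
    have htab : TabEncl L f (fTab L c d) := by
      rw [hfe]; exact tabEncl_fTab (by omega) hlam0 hcx hxd hgc
    have horc : ∀ e1 e2 r1 r2 : ℕ, e1 < L → e2 < L → r1 < L → r2 < L →
        mem (Dgrad L f ((((e1 : ℕ) : ZMod L)), (((e2 : ℕ) : ZMod L))) ((((r1 : ℕ) : ZMod L)), (((r2 : ℕ) : ZMod L))))
          (cellOracle L c d e1 e2 r1 r2) := by
      rw [hfe]; exact mem_cellOracle (by omega) hlam0 hcx hxd hgc
    have mN : mem (PiNormSq L f) (NIv L (fTab L c d)) := mem_PiNormSq htab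
    have mS : mem (∑ cc : Cfg L, piR L f cc * C0fn L Δ lam2 f cc) (SIvD L (fTab L c d) (cellOracle L c d)) :=
      mem_SIvD (by omega) hf2 htab horc
    -- `N > 0`
    have hNpos : 0 < PiNormSq L f := by
      obtain ⟨hlo, _⟩ := mN
      have : (0 : ℝ) < (((NIv L (fTab L c d)).1 : ℤ) : ℝ) := by exact_mod_cast hN
      nlinarith
    -- `T⁺ = 3λ + S/N`
    have hS := sum_piR_C0fn L hf2
    have hTeq : Tplus L Δ f = 3 * lam2 + (∑ cc : Cfg L, piR L f cc * C0fn L Δ lam2 f cc) * (1 / PiNormSq L f) := by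
      rw [hS]; field_simp; ring
    have mT : mem (Tplus L Δ f) (tplusIv2 L c d) := by
      rw [hTeq]
      unfold tplusIv2
      have h3 : mem (3 * lam2) (iscale 3 (c, d)) := by
        have := mem_iscale 3 (mem_lam hcx hxd); push_cast at this; exact this
      exact mem_iadd h3 (mem_imul mS (mem_iinv mN hN))
    have mB := mem_bound L (by omega)
    obtain ⟨_, hThi⟩ := mT
    obtain ⟨hBlo, _⟩ := mB
    have hle : ((((tplusIv2 L c d).2 : ℤ)) : ℝ) ≤ ((((boundIv L).1 : ℤ)) : ℝ) := by exact_mod_cast hT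
    unfold mHole
    nlinarith

end FinCell

end Summit.HubbardSuperconductivity.HubbardSuperconductivity.Theorems.AnisotropyChord.Transfer.Fibre3

end
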